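import Mathlib

/-!
# SoloBlindNearRoot — the slaved near root of the window law: no fold on `R ≥ 0`, and its explicit (T1c)/(T5) constants

Solo-blind programme on `AnomalousDissipation`, paper §24.68(3)–(5) ((T1c): 'no interior fold of the
slaving', (T5): 'second-derivative / Lipschitz bounds of the rescaled nonlinearity — the near root away
from its fold'), CLAIMS SB-C699.  In the reduced outer problem `A q‴ = −μ_near` the shear is SLAVED to
`R = S − s₀ A q″ − g q` through the window law `κ μ² + |b| μ = R` (`κ > 0`, `b ≠ 0`), and the branch used is
the NEAR root, written in the cancellation-free form `μ_near = 2R / (√(b² + 4κR) + |b|)`.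
We certify, for `R ≥ 0` (which holds on the live interval by design):

* `nearDisc_pos`, `abs_le_sqrt_nearDisc` : the discriminant `D = b² + 4κR ≥ b² > 0` — the fold
  `D = 0` (`R = −b²/(4κ)`, the 'window floor') lies strictly below: NO FOLD on `R ≥ 0`;
* `nearRoot_eq_quadratic_formula`, `nearRoot_is_root` : `μ_near = (√D − |b|)/(2κ)` and it solves the
  window law;
* `nearRoot_nonneg`, `nearRoot_le` : `0 ≤ μ_near ≤ R/|b|` (the linear-response bound);
* `nearRoot_sub`, `abs_nearRoot_sub_le` : the exact difference formula
  `μ(R₁) − μ(R₂) = 2(R₁ − R₂)/(√D₁ + √D₂)` and the LIPSCHITZ constant `1/|b|` on `R ≥ 0`;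
* `hasDerivAt_nearRoot`, `nearRoot_deriv_pos`, `nearRoot_deriv_le` : `dμ_near/dR = 1/√D ∈ (0, 1/|b|]`.

Elementary real algebra and one-variable calculus; nothing about the outer problem itself is claimed.
-/

namespace Summit.AnomalousDissipation.AnomalousDissipation.Theorems

/-- Discriminant of the window law `κ μ² + |b| μ = R`: `D(b, κ, R) = b² + 4κR`. -/
noncomputable def nearDisc (b κ R : ℝ) : ℝ := b ^ 2 + 4 * κ * R

/-- The slaved near root in cancellation-free form, `μ_near = 2R / (√(b² + 4κR) + |b|)`. -/
noncomputable def nearRoot (b κ R : ℝ) : ℝ := 2 * R / (Real.sqrt (nearDisc b κ R) + |b|)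

/-- On `R ≥ 0` (with `κ ≥ 0`) the discriminant dominates `b²`. -/
theorem sq_le_nearDisc {b κ R : ℝ} (hκ : 0 ≤ κ) (hR : 0 ≤ R) : b ^ 2 ≤ nearDisc b κ R := by
  unfold nearDisc; nlinarith [mul_nonneg hκ hR]

/-- (T1c) NO FOLD on `R ≥ 0`: the discriminant is strictly positive when `b ≠ 0`. -/
theorem nearDisc_pos {b κ R : ℝ} (hb : b ≠ 0) (hκ : 0 ≤ κ) (hR : 0 ≤ R) : 0 < nearDisc b κ R :=
  lt_of_lt_of_le (by positivity) (sq_le_nearDisc (b := b) hκ hR)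

/-- `|b| ≤ √D` on `R ≥ 0`. -/
theorem abs_le_sqrt_nearDisc {b κ R : ℝ} (hκ : 0 ≤ κ) (hR : 0 ≤ R) :
    |b| ≤ Real.sqrt (nearDisc b κ R) := by
  rw [← Real.sqrt_sq_eq_abs]
  exact Real.sqrt_le_sqrt (sq_le_nearDisc hκ hR)

/-- `(√D)² = b² + 4κR` on `R ≥ 0`. -/
theorem sqrt_nearDisc_sq {b κ R : ℝ} (hκ : 0 ≤ κ) (hR : 0 ≤ R) :
    Real.sqrt (nearDisc b κ R) ^ 2 = b ^ 2 + 4 * κ * R := by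
  rw [Real.sq_sqrt (le_trans (sq_nonneg b) (sq_le_nearDisc hκ hR))]; rfl

/-- Pure algebra behind `nearRoot_is_root`: with `R = (S² − β²)/(4κ)`,
`κ (2R/(S+β))² + β (2R/(S+β)) = R`. -/
private lemma root_identity (S β κ : ℝ) (hS : 0 < S) (hβ : 0 ≤ β) (hκ : 0 < κ) :
    κ * (2 * ((S ^ 2 - β ^ 2) / (4 * κ)) / (S + β)) ^ 2
      + β * (2 * ((S ^ 2 - β ^ 2) / (4 * κ)) / (S + β)) = (S ^ 2 - β ^ 2) / (4 * κ) := by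
  have h1 : S + β ≠ 0 := by positivity
  have h2 : κ ≠ 0 := hκ.ne'
  field_simp
  ring

/-- Pure algebra behind `hasDerivAt_nearRoot`: with `R = (S² − β²)/(4κ)`, the quotient-rule value
`(2(S+β) − 2R·(4κ/(2S)))/(S+β)²` equals `1/S`. -/
private lemma deriv_identity (S β κ : ℝ) (hS : 0 < S) (hβ : 0 ≤ β) (hκ : 0 < κ) :
    (2 * (S + β) - 2 * ((S ^ 2 - β ^ 2) / (4 * κ)) * (4 * κ / (2 * S))) / (S + β) ^ 2 = 1 / S := by
  have h1 : S + β ≠ 0 := by positivity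
  have h2 : κ ≠ 0 := hκ.ne'
  have h3 : S ≠ 0 := hS.ne'
  field_simp
  ring

/-- On `R ≥ 0`, `R = ((√D)² − |b|²)/(4κ)`. -/
theorem R_eq_of_sqrt_nearDisc {b κ R : ℝ} (hκ : 0 < κ) (hR : 0 ≤ R) :
    R = (Real.sqrt (nearDisc b κ R) ^ 2 - |b| ^ 2) / (4 * κ) := by
  rw [sqrt_nearDisc_sq hκ.le hR, sq_abs]
  field_simp
  ring

/-- The cancellation-free form equals the quadratic-formula form `(√D − |b|)/(2κ)` (`b ≠ 0`). -/
theorem nearRoot_eq_quadratic_formula {b κ R : ℝ} (hb : b ≠ 0) (hκ : 0 < κ) (hR : 0 ≤ R) :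
    nearRoot b κ R = (Real.sqrt (nearDisc b κ R) - |b|) / (2 * κ) := by
  have hSpos : 0 < Real.sqrt (nearDisc b κ R) := Real.sqrt_pos.mpr (nearDisc_pos hb hκ.le hR)
  have hsq := sqrt_nearDisc_sq (b := b) hκ.le hR
  unfold nearRoot
  rw [div_eq_div_iff (by positivity) (by positivity)]
  nlinarith [hsq, sq_abs b]

/-- The near root SOLVES the window law `κ μ² + |b| μ = R` (for `b ≠ 0`, `κ > 0`, `R ≥ 0`). -/
theorem nearRoot_is_root {b κ R : ℝ} (hb : b ≠ 0) (hκ : 0 < κ) (hR : 0 ≤ R) :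
    κ * nearRoot b κ R ^ 2 + |b| * nearRoot b κ R = R := by
  have hSpos : 0 < Real.sqrt (nearDisc b κ R) := Real.sqrt_pos.mpr (nearDisc_pos hb hκ.le hR)
  have hRe := R_eq_of_sqrt_nearDisc (b := b) hκ hR
  have key := root_identity (Real.sqrt (nearDisc b κ R)) |b| κ hSpos (abs_nonneg b) hκ
  unfold nearRoot
  rw [hRe]
  convert key using 3 <;> rw [← hRe]

/-- `μ_near ≥ 0` on `R ≥ 0`. -/
theorem nearRoot_nonneg {b κ R : ℝ} (hR : 0 ≤ R) : 0 ≤ nearRoot b κ R := by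
  unfold nearRoot; positivity

/-- Linear-response bound: `μ_near ≤ R/|b|` on `R ≥ 0` (`b ≠ 0`, `κ ≥ 0`). -/
theorem nearRoot_le {b κ R : ℝ} (hb : b ≠ 0) (hκ : 0 ≤ κ) (hR : 0 ≤ R) :
    nearRoot b κ R ≤ R / |b| := by
  have habs : 0 < |b| := abs_pos.mpr hb
  have hS : |b| ≤ Real.sqrt (nearDisc b κ R) := abs_le_sqrt_nearDisc hκ hR
  unfold nearRoot
  calc 2 * R / (Real.sqrt (nearDisc b κ R) + |b|) ≤ 2 * R / (2 * |b|) :=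
        div_le_div_of_nonneg_left (by positivity) (by positivity) (by linarith)
    _ = R / |b| := mul_div_mul_left R |b| two_ne_zero

/-- Exact difference formula: `μ(R₁) − μ(R₂) = 2 (R₁ − R₂) / (√D₁ + √D₂)` on `R ≥ 0`. -/
theorem nearRoot_sub {b κ R₁ R₂ : ℝ} (hb : b ≠ 0) (hκ : 0 < κ) (h₁ : 0 ≤ R₁) (h₂ : 0 ≤ R₂) :
    nearRoot b κ R₁ - nearRoot b κ R₂
      = 2 * (R₁ - R₂) / (Real.sqrt (nearDisc b κ R₁) + Real.sqrt (nearDisc b κ R₂)) := by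
  have hS1 : 0 < Real.sqrt (nearDisc b κ R₁) := Real.sqrt_pos.mpr (nearDisc_pos hb hκ.le h₁)
  have hS2 : 0 < Real.sqrt (nearDisc b κ R₂) := Real.sqrt_pos.mpr (nearDisc_pos hb hκ.le h₂)
  have hq1 := sqrt_nearDisc_sq (b := b) hκ.le h₁
  have hq2 := sqrt_nearDisc_sq (b := b) hκ.le h₂
  rw [nearRoot_eq_quadratic_formula hb hκ h₁, nearRoot_eq_quadratic_formula hb hκ h₂]
  rw [div_sub_div_same, div_eq_div_iff (by positivity) (by positivity)]
  nlinarith [hq1, hq2]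

/-- (T5) LIPSCHITZ CONSTANT `1/|b|` of the slaving on `R ≥ 0`. -/
theorem abs_nearRoot_sub_le {b κ R₁ R₂ : ℝ} (hb : b ≠ 0) (hκ : 0 < κ) (h₁ : 0 ≤ R₁) (h₂ : 0 ≤ R₂) :
    |nearRoot b κ R₁ - nearRoot b κ R₂| ≤ |R₁ - R₂| / |b| := by
  have habs : 0 < |b| := abs_pos.mpr hb
  have hS1 : |b| ≤ Real.sqrt (nearDisc b κ R₁) := abs_le_sqrt_nearDisc hκ.le h₁
  have hS2 : |b| ≤ Real.sqrt (nearDisc b κ R₂) := abs_le_sqrt_nearDisc hκ.le h₂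
  have hden : 0 < Real.sqrt (nearDisc b κ R₁) + Real.sqrt (nearDisc b κ R₂) := by linarith
  rw [nearRoot_sub hb hκ h₁ h₂, abs_div, abs_of_pos hden, abs_mul, abs_two]
  calc 2 * |R₁ - R₂| / (Real.sqrt (nearDisc b κ R₁) + Real.sqrt (nearDisc b κ R₂))
        ≤ 2 * |R₁ - R₂| / (2 * |b|) :=
          div_le_div_of_nonneg_left (by positivity) (by positivity) (by linarith)
    _ = |R₁ - R₂| / |b| := mul_div_mul_left _ _ two_ne_zero

/-- `dμ_near/dR = 1/√D` at every `R ≥ 0` (`b ≠ 0`, `κ > 0`). -/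
theorem hasDerivAt_nearRoot {b κ R : ℝ} (hb : b ≠ 0) (hκ : 0 < κ) (hR : 0 ≤ R) :
    HasDerivAt (fun r => nearRoot b κ r) (1 / Real.sqrt (nearDisc b κ R)) R := by
  have hD : 0 < nearDisc b κ R := nearDisc_pos hb hκ.le hR
  have hSpos : 0 < Real.sqrt (nearDisc b κ R) := Real.sqrt_pos.mpr hD
  have h1 : HasDerivAt (fun r => nearDisc b κ r) (4 * κ) R := by
    have := ((hasDerivAt_id R).const_mul (4 * κ)).const_add (b ^ 2)
    simpa [nearDisc] using this
  have h2 : HasDerivAt (fun r => Real.sqrt (nearDisc b κ r))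
      (4 * κ / (2 * Real.sqrt (nearDisc b κ R))) R := h1.sqrt hD.ne'
  have h3 : HasDerivAt (fun r => Real.sqrt (nearDisc b κ r) + |b|)
      (4 * κ / (2 * Real.sqrt (nearDisc b κ R))) R := h2.add_const |b|
  have hden : Real.sqrt (nearDisc b κ R) + |b| ≠ 0 := by positivity
  have h4 : HasDerivAt (fun r : ℝ => 2 * r) 2 R := by
    simpa using (hasDerivAt_id R).const_mul (2 : ℝ)
  have h5 := h4.div h3 hden
  have hRe := R_eq_of_sqrt_nearDisc (b := b) hκ hR
  have key := deriv_identity (Real.sqrt (nearDisc b κ R)) |b| κ hSpos (abs_nonneg b) hκ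
  rw [← hRe] at key
  unfold nearRoot
  exact h5.congr_deriv key

/-- The slaving is strictly increasing in `R`: `dμ_near/dR > 0`. -/
theorem nearRoot_deriv_pos {b κ R : ℝ} (hb : b ≠ 0) (hκ : 0 ≤ κ) (hR : 0 ≤ R) :
    0 < 1 / Real.sqrt (nearDisc b κ R) :=
  one_div_pos.mpr (Real.sqrt_pos.mpr (nearDisc_pos hb hκ hR))

/-- (T5) derivative bound: `dμ_near/dR ≤ 1/|b|` on `R ≥ 0`. -/
theorem nearRoot_deriv_le {b κ R : ℝ} (hb : b ≠ 0) (hκ : 0 ≤ κ) (hR : 0 ≤ R) :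
    1 / Real.sqrt (nearDisc b κ R) ≤ 1 / |b| :=
  one_div_le_one_div_of_le (abs_pos.mpr hb) (abs_le_sqrt_nearDisc hκ hR)

end Summit.AnomalousDissipation.AnomalousDissipation.Theorems
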